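import Mathlib.NumberTheory.Padics.Complex
import Mathlib.NumberTheory.Padics.RingHoms
import Mathlib.RingTheory.AdjoinRoot
import Mathlib.RingTheory.Polynomial.GaussLemma
import Mathlib.Algebra.Polynomial.SpecificDegree
import Mathlib.RingTheory.DiscreteValuationRing.Basic
import Mathlib.RingTheory.Polynomial.RationalRoot
import Mathlib.Algebra.Module.ZMod
import Mathlib.RingTheory.Nakayama
import Mathlib.RingTheory.OrzechProperty
import Mathlib.RingTheory.FiniteType
import Mathlib.LinearAlgebra.Dimension.Free
import Mathlib.LinearAlgebra.FreeModule.Finite.Basic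
import Mathlib.LinearAlgebra.Trace
import Mathlib.RingTheory.Trace.Basic
import Mathlib.RingTheory.Flat.Localization
import Mathlib.RingTheory.Localization.FractionRing
import Mathlib.LinearAlgebra.FiniteDimensional.Lemmas
import HarnessLib

/-!
# The `3`-adic Eisenstein order `ℤ₃[ω] = ℤ₃[X]/(X² + X + 1)`

Topic `Literature/NumberTheory/GaloisRepresentations`.  The coefficient ring of the `λ`-adic
representations of `Γ_{ℚ(ω)}` attached to curves with an automorphism of order `3` defined over
`ℚ(ω)` (Picard curves `y³ = f₄(x)`, Upton 2009): the Tate module `T₃ J` is a module over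
`ℤ[ω] ⊗ ℤ₃ = ℤ₃[ω]`, `ω` acting as the automorphism, and `ℤ₃[ω]` is the ring of integers of the
ramified quadratic extension `ℚ₃(ω) = ℚ₃(√-3)` of `ℚ₃`, with uniformizer `λ = 1 - ω`, `λ² = -3ω`.

* `PadicEisenstein` — the commutative `ℤ₃`-algebra `ℤ₃[ω] := AdjoinRoot (X² + X + 1 : ℤ₃[X])`, with
  `ω = PadicEisenstein.omega`, `ω² + ω + 1 = 0`, `ω³ = 1`, the power basis `{1, ω}` over `ℤ₃`
  (`PadicEisenstein.basis`, Mathlib `AdjoinRoot.powerBasis'`), `λ = 1 - ω` with `λ² = -3ω`;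
* `PadicEisenstein.not_exists_sq_add_self_add_one_eq_zero` — `X² + X + 1` has no root in `ℚ₃`
  (a root would be a `3`-adic unit `≡ 1 (mod 3)`, and `x² + x + 1 ≢ 0 (mod 9)`), whence
  `X² + X + 1` is irreducible over `ℚ₃` and prime in `ℤ₃[X]` and **`ℤ₃[ω]` is a domain**
  (`PadicEisenstein.instIsDomain`);
* `PadicEisenstein.lift` — the `ℤ₃`-algebra homomorphism `ℤ₃[ω] → C`, `ω ↦ u`, for any `u` with
  `u² + u + 1 = 0` in a (possibly non-commutative) `ℤ₃`-algebra `C` (the two embeddings into `ℚ̄₃`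
  attached to the two primitive cube roots of unity; the module structure below);
* `PadicEisenstein.moduleOfEnd` — the `ℤ₃[ω]`-module structure on a `ℤ₃`-module `T` given by an
  endomorphism `δ` with `δ² + δ + 1 = 0` (the Tate module of a curve with an automorphism of order
  `3`), and `PadicEisenstein.nonempty_basis_of_card_quotient` — **freeness over `ℤ₃[ω]`**: a
  `ℤ₃[ω]`-module free of rank `2r` over `ℤ₃` with `#(T/λT) = 3^r` is free of rank `r` over `ℤ₃[ω]`
  (Nakayama over `ℤ₃` + Orzech; no structure theory of `ℤ₃[ω]`-modules is needed);
* `PadicEisenstein.trace_add_mul_omega` — `Tr_{ℤ₃[ω]/ℤ₃}(a + bω) = 2a - b`;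
  `trace_restrictScalars_eq_trace_trace` — `Tr_R(A) = Tr_{S/R}(Tr_S A)` for an `S`-linear
  endomorphism; `trace_eq_of_injective_of_comp_eq` — an injective intertwiner between free modules of
  the same finite rank over a domain preserves traces (the reduction map on Tate modules).

Everything is proved (definitions with bodies + lemmas); no named facts.  Serre, *Abelian ℓ-adic
representations* I.§1 (`λ`-adic representations with coefficients in `E_λ`); Upton 2009 (the
`(1 - ζ₃)`-adic representations of Picard curves).

## References
* J.-P. Serre, *Abelian ℓ-adic representations and elliptic curves* (1968), Ch. I §1.1, §2.3
  (`E_λ`-coefficients). [SerreAbelianLadic1968]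
* J.-P. Serre, *Local Fields*, Ch. I §6 (Eisenstein polynomials; totally ramified extensions).
  [SerreLocalFields1979]
-/

noncomputable section

open Polynomial

namespace Literature.NumberTheory.GaloisRepresentations

/-- The polynomial `X² + X + 1 ∈ ℤ₃[X]`. [folklore] -/
def eisensteinCubicPoly : ℤ_[3][X] := X ^ 2 + X + 1

/-- Unfolding lemma. [folklore] -/
theorem eisensteinCubicPoly_eq : eisensteinCubicPoly = X ^ 2 + X + 1 := rfl

/-- `X² + X + 1` is monic. [folklore] -/
theorem monic_eisensteinCubicPoly : eisensteinCubicPoly.Monic := by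
  rw [eisensteinCubicPoly_eq]
  monicity!

/-- `deg (X² + X + 1) = 2`. [folklore] -/
theorem natDegree_eisensteinCubicPoly : eisensteinCubicPoly.natDegree = 2 := by
  rw [eisensteinCubicPoly_eq]
  compute_degree!

/-- **The `3`-adic Eisenstein order `ℤ₃[ω] = ℤ₃[X]/(X² + X + 1)`**, the ring of integers of
`ℚ₃(ω) = ℚ₃(√-3)`. [cite: SerreAbelianLadic1968, Ch. I §2.3] -/
abbrev PadicEisenstein : Type := AdjoinRoot eisensteinCubicPoly

namespace PadicEisenstein

/-- `ω ∈ ℤ₃[ω]`, the class of `X`. [folklore] -/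
def omega : PadicEisenstein := AdjoinRoot.root eisensteinCubicPoly

local notation "ω" => omega

/-- `ω² + ω + 1 = 0`. [folklore] -/
theorem omega_sq_add_omega_add_one : ω ^ 2 + ω + 1 = 0 := by
  have h := AdjoinRoot.eval₂_root eisensteinCubicPoly
  rwa [eisensteinCubicPoly_eq, eval₂_add, eval₂_add, eval₂_X_pow, eval₂_X, eval₂_one] at h

/-- `ω³ = 1`. [folklore] -/
theorem omega_pow_three : ω ^ 3 = 1 := by
  have h := omega_sq_add_omega_add_one
  linear_combination (ω - 1) * h

/-- `ω` is a unit. [folklore] -/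
theorem isUnit_omega : IsUnit ω :=
  isUnit_iff_exists_inv.2 ⟨ω ^ 2, by rw [← pow_succ', omega_pow_three]⟩

/-- `ℤ₃[ω]` is nontrivial. [folklore] -/
instance instNontrivial : Nontrivial PadicEisenstein :=
  AdjoinRoot.nontrivial eisensteinCubicPoly (by
    rw [degree_eq_natDegree monic_eisensteinCubicPoly.ne_zero, natDegree_eisensteinCubicPoly]; decide)

/-- The power basis `{1, ω}` of `ℤ₃[ω]` over `ℤ₃` (Mathlib `AdjoinRoot.powerBasis'` for the monic
`X² + X + 1`). [folklore] -/
def powerBasis : PowerBasis ℤ_[3] PadicEisenstein :=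
  AdjoinRoot.powerBasis' monic_eisensteinCubicPoly

/-- The power basis has dimension `2`. [folklore] -/
theorem powerBasis_dim : powerBasis.dim = 2 := by
  rw [powerBasis, AdjoinRoot.powerBasis'_dim, natDegree_eisensteinCubicPoly]

/-- The power basis is generated by `ω`. [folklore] -/
theorem powerBasis_gen : powerBasis.gen = ω := by
  rw [powerBasis, AdjoinRoot.powerBasis'_gen]; rfl

/-- `ℤ₃[ω]` is a free `ℤ₃`-module (of rank `2`). [folklore] -/
instance instFree : Module.Free ℤ_[3] PadicEisenstein := Module.Free.of_basis powerBasis.basis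

/-- `ℤ₃[ω]` is a finite `ℤ₃`-module. [folklore] -/
instance instFinite : Module.Finite ℤ_[3] PadicEisenstein := powerBasis.finite

/-- `rank_{ℤ₃} ℤ₃[ω] = 2`. [folklore] -/
theorem finrank_eq_two : Module.finrank ℤ_[3] PadicEisenstein = 2 := by
  rw [powerBasis.finrank, powerBasis_dim]

/-- Every element of `ℤ₃[ω]` is `a + b ω` with `a, b ∈ ℤ₃`. [folklore] -/
theorem exists_eq_add_mul_omega (z : PadicEisenstein) :
    ∃ a b : ℤ_[3], z = algebraMap ℤ_[3] _ a + algebraMap ℤ_[3] _ b * ω := by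
  obtain ⟨g, hg, rfl⟩ := powerBasis.exists_eq_aeval z
  rw [powerBasis_dim] at hg
  refine ⟨g.coeff 0, g.coeff 1, ?_⟩
  conv_lhs => rw [eq_X_add_C_of_natDegree_le_one (Nat.lt_succ_iff.mp hg)]
  rw [powerBasis_gen, map_add, map_mul, aeval_C, aeval_X, aeval_C]
  ring

/-- The uniformizer `λ = 1 - ω`. [folklore] -/
def lam : PadicEisenstein := 1 - ω

local notation "λ'" => lam

/-- **`λ² = -3ω`** (`(1 - ω)² = 1 - 2ω + ω² = -3ω`): `3 = -ω⁻¹ λ²` is `λ²` times a unit, the ramification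
of `3` in `ℤ[ω]`. [cite: SerreLocalFields1979, Ch. I §6] -/
theorem lam_sq : λ' ^ 2 = -3 * ω := by
  have h := omega_sq_add_omega_add_one
  simp only [lam]
  linear_combination h

/-- `3 = -ω² λ²` in `ℤ₃[ω]`. [folklore] -/
theorem three_eq : (3 : PadicEisenstein) = -(ω ^ 2 * λ' ^ 2) := by
  rw [lam_sq]
  have h3 := omega_pow_three
  linear_combination (-3 : PadicEisenstein) * h3

/-! ### `X² + X + 1` has no root in `ℚ₃`; `ℤ₃[ω]` is a domain -/

/-- `y² + y + 1 ≠ 0` for every residue `y (mod 9)`. [folklore] -/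
theorem zmod_nine_sq_add_self_add_one_ne_zero : ∀ y : ZMod 9, y ^ 2 + y + 1 ≠ 0 := by decide

/-- **`ℚ₃` contains no primitive cube root of unity**: `x² + x + 1 = 0` has no solution in `ℚ₃`
(a solution is a `3`-adic integer — if `‖x‖ > 1` then `‖x²‖ > ‖x + 1‖` — and `x² + x + 1 ≢ 0 (mod 9)`).
[cite: SerreLocalFields1979, Ch. I §6] -/
theorem not_exists_sq_add_self_add_one_eq_zero : ¬ ∃ x : ℚ_[3], x ^ 2 + x + 1 = 0 := by
  rintro ⟨x, hx⟩
  -- `x` is a `3`-adic integer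
  have hle : ‖x‖ ≤ 1 := by
    by_contra hlt
    rw [not_le] at hlt
    have h1 : ‖x + 1‖ = ‖x‖ := by
      rw [Padic.add_eq_max_of_ne (by rw [norm_one]; exact hlt.ne'), norm_one, max_eq_left hlt.le]
    have h2 : x ^ 2 = -(x + 1) := by linear_combination hx
    have h3 : ‖x‖ ^ 2 = ‖x‖ := by rw [← norm_pow, h2, norm_neg, h1]
    have hx0 : 0 < ‖x‖ := lt_trans zero_lt_one hlt
    have : ‖x‖ = 1 := by
      have h4 : ‖x‖ * ‖x‖ = ‖x‖ * 1 := by rw [mul_one, ← sq, h3]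
      exact mul_left_cancel₀ hx0.ne' h4
    exact hlt.ne' this
  set z : ℤ_[3] := ⟨x, hle⟩ with hz
  have hz2 : z ^ 2 + z + 1 = 0 := by
    apply Subtype.ext
    simpa [hz] using hx
  have h9 := congrArg (PadicInt.toZModPow 2) hz2
  rw [map_add, map_add, map_pow, map_one, map_zero] at h9
  exact zmod_nine_sq_add_self_add_one_ne_zero _ h9

/-- `X² + X + 1` is irreducible over `ℚ₃`. [folklore] -/
theorem irreducible_map_eisensteinCubicPoly :
    Irreducible (eisensteinCubicPoly.map (algebraMap ℤ_[3] ℚ_[3])) := by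
  have hmon : (eisensteinCubicPoly.map (algebraMap ℤ_[3] ℚ_[3])).Monic := monic_eisensteinCubicPoly.map _
  have hdeg : (eisensteinCubicPoly.map (algebraMap ℤ_[3] ℚ_[3])).natDegree = 2 := by
    rw [monic_eisensteinCubicPoly.natDegree_map, natDegree_eisensteinCubicPoly]
  rw [Polynomial.Monic.irreducible_iff_roots_eq_zero_of_degree_le_three hmon (by rw [hdeg]) (by rw [hdeg]; norm_num),
    Multiset.eq_zero_iff_forall_notMem]
  intro x hx
  rw [mem_roots hmon.ne_zero, IsRoot.def, eval_map, eisensteinCubicPoly_eq, eval₂_add, eval₂_add,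
    eval₂_X_pow, eval₂_X, eval₂_one] at hx
  exact not_exists_sq_add_self_add_one_eq_zero ⟨x, hx⟩

/-- `X² + X + 1` is irreducible in `ℤ₃[X]` (Gauss's lemma). [folklore] -/
theorem irreducible_eisensteinCubicPoly : Irreducible eisensteinCubicPoly :=
  (monic_eisensteinCubicPoly.irreducible_iff_irreducible_map_fraction_map (K := ℚ_[3])).2
    irreducible_map_eisensteinCubicPoly

/-- `X² + X + 1` is prime in `ℤ₃[X]`. [folklore] -/
theorem prime_eisensteinCubicPoly : Prime eisensteinCubicPoly :=
  irreducible_eisensteinCubicPoly.prime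

/-- **`ℤ₃[ω]` is an integral domain** (the ring of integers of the field `ℚ₃(ω)`). [folklore] -/
instance instIsDomain : IsDomain PadicEisenstein :=
  AdjoinRoot.isDomain_of_prime prime_eisensteinCubicPoly

/-! ### The embeddings `ℤ₃[ω] → C`, `ω ↦ u`, for `u² + u + 1 = 0` -/

section Lift

variable {C : Type*} [Ring C] [Algebra ℤ_[3] C]

/-- `aeval u (X² + X + 1) = u² + u + 1`. [folklore] -/
theorem aeval_eisensteinCubicPoly (u : C) : aeval u eisensteinCubicPoly = u ^ 2 + u + 1 := by
  rw [eisensteinCubicPoly_eq, map_add, map_add, map_pow, aeval_X, map_one]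

/-- The `ℤ₃`-algebra homomorphism `ℤ₃[ω] → C` sending `ω` to a given root `u` of `X² + X + 1` in a
(possibly non-commutative) `ℤ₃`-algebra `C`; for `C = ℚ̄₃` and `u` a primitive cube root of unity this is
one of the two embeddings `ℤ₃[ω] ↪ ℚ̄₃`, and for `C = End(T)` and `u = δ` an endomorphism with
`δ² + δ + 1 = 0` it is the `ℤ₃[ω]`-module structure `moduleOfEnd`. [folklore] -/
def lift (u : C) (hu : u ^ 2 + u + 1 = 0) : PadicEisenstein →ₐ[ℤ_[3]] C :=
  Ideal.Quotient.liftₐ (Ideal.span {eisensteinCubicPoly}) (Polynomial.aeval u) (fun a ha => by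
    obtain ⟨b, rfl⟩ := Ideal.mem_span_singleton'.1 ha
    rw [map_mul, aeval_eisensteinCubicPoly, hu, mul_zero])

/-- `lift u` on the class of a polynomial `g` is `g(u)`. [folklore] -/
theorem lift_mk (u : C) (hu : u ^ 2 + u + 1 = 0) (g : ℤ_[3][X]) :
    lift u hu (AdjoinRoot.mk eisensteinCubicPoly g) = aeval u g :=
  rfl

/-- `lift u` sends `ω` to `u`. [folklore] -/
@[simp]
theorem lift_omega (u : C) (hu : u ^ 2 + u + 1 = 0) : lift u hu ω = u := by
  rw [omega, AdjoinRoot.root, lift_mk, aeval_X]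

/-- `lift u` on `ℤ₃`. [folklore] -/
theorem lift_algebraMap (u : C) (hu : u ^ 2 + u + 1 = 0) (a : ℤ_[3]) :
    lift u hu (algebraMap ℤ_[3] _ a) = algebraMap ℤ_[3] C a :=
  AlgHom.commutes _ a

/-- `lift u (a + b ω) = a + b u`. [folklore] -/
theorem lift_add_mul_omega (u : C) (hu : u ^ 2 + u + 1 = 0) (a b : ℤ_[3]) :
    lift u hu (algebraMap ℤ_[3] _ a + algebraMap ℤ_[3] _ b * ω) = algebraMap ℤ_[3] C a + algebraMap ℤ_[3] C b * u := by
  rw [map_add, map_mul, lift_algebraMap, lift_algebraMap, lift_omega]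

/-- `lift u λ = 1 - u`. [folklore] -/
theorem lift_lam (u : C) (hu : u ^ 2 + u + 1 = 0) : lift u hu λ' = 1 - u := by
  rw [lam, map_sub, map_one, lift_omega]

end Lift

/-! ### Modules over `ℤ₃[ω]`: the structure defined by an endomorphism `δ` with `δ² + δ + 1 = 0` -/

section ModuleOfEnd

variable {T : Type*} [AddCommGroup T] [Module ℤ_[3] T]

/-- **The `ℤ₃[ω]`-module structure on a `ℤ₃`-module `T` defined by an endomorphism `δ` with
`δ² + δ + 1 = 0`** (`ω` acting as `δ`): for the Tate module of a curve with an automorphism of order `3`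
(`δ =` the automorphism).  A reducible non-instance (use with `letI := moduleOfEnd δ hδ`).
[cite: SerreAbelianLadic1968, Ch. I §2.3] -/
abbrev moduleOfEnd (δ : Module.End ℤ_[3] T) (hδ : δ ^ 2 + δ + 1 = 0) : Module PadicEisenstein T :=
  Module.compHom T (lift (C := Module.End ℤ_[3] T) δ hδ).toRingHom

/-- Under `moduleOfEnd δ hδ`, `z • t = (lift δ z) t`. [folklore] -/
theorem moduleOfEnd_smul_def (δ : Module.End ℤ_[3] T) (hδ : δ ^ 2 + δ + 1 = 0) (z : PadicEisenstein)
    (t : T) : letI := moduleOfEnd δ hδ; z • t = lift (C := Module.End ℤ_[3] T) δ hδ z t :=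
  rfl

/-- Under `moduleOfEnd δ hδ`, `ω • t = δ t`. [folklore] -/
theorem moduleOfEnd_omega_smul (δ : Module.End ℤ_[3] T) (hδ : δ ^ 2 + δ + 1 = 0) (t : T) :
    letI := moduleOfEnd δ hδ; ω • t = δ t := by
  letI := moduleOfEnd δ hδ
  rw [moduleOfEnd_smul_def, lift_omega]

/-- Under `moduleOfEnd δ hδ` the `ℤ₃`- and `ℤ₃[ω]`-actions are compatible. [folklore] -/
theorem moduleOfEnd_isScalarTower (δ : Module.End ℤ_[3] T) (hδ : δ ^ 2 + δ + 1 = 0) :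
    letI := moduleOfEnd δ hδ; IsScalarTower ℤ_[3] PadicEisenstein T := by
  letI := moduleOfEnd δ hδ
  constructor
  intro a z t
  rw [moduleOfEnd_smul_def, moduleOfEnd_smul_def, map_smul, LinearMap.smul_apply]

/-- Under `moduleOfEnd δ hδ`, `algebraMap ℤ₃ ℤ₃[ω] a • t = a • t`. [folklore] -/
theorem moduleOfEnd_algebraMap_smul (δ : Module.End ℤ_[3] T) (hδ : δ ^ 2 + δ + 1 = 0) (a : ℤ_[3])
    (t : T) : letI := moduleOfEnd δ hδ; algebraMap ℤ_[3] PadicEisenstein a • t = a • t := by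
  letI := moduleOfEnd δ hδ
  rw [moduleOfEnd_smul_def, lift_algebraMap, Module.algebraMap_end_apply]

/-- Under `moduleOfEnd δ hδ`, a `ℤ₃`-linear endomorphism commuting with `δ` is `ℤ₃[ω]`-linear. [folklore] -/
theorem moduleOfEnd_map_smul (δ : Module.End ℤ_[3] T) (hδ : δ ^ 2 + δ + 1 = 0) (A : Module.End ℤ_[3] T)
    (hA : A * δ = δ * A) (z : PadicEisenstein) (t : T) :
    letI := moduleOfEnd δ hδ; A (z • t) = z • A t := by
  letI := moduleOfEnd δ hδ
  obtain ⟨a, b, rfl⟩ := exists_eq_add_mul_omega z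
  rw [moduleOfEnd_smul_def, moduleOfEnd_smul_def, lift_add_mul_omega]
  have hA' : ∀ x, A (δ x) = δ (A x) := fun x => by rw [← Module.End.mul_apply, hA, Module.End.mul_apply]
  simp only [LinearMap.add_apply, Module.End.mul_apply, Module.algebraMap_end_apply, map_add, map_smul, hA']

end ModuleOfEnd

/-! ### Freeness over `ℤ₃[ω]` from the `ℤ₃`-rank and the size of `T/λT` (Nakayama) -/

section Free

variable {T : Type*} [AddCommGroup T] [Module PadicEisenstein T]

variable (T) in
/-- `λT`, the image of multiplication by `λ = 1 - ω`. [folklore] -/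
def lamSubmodule : Submodule PadicEisenstein T :=
  LinearMap.range (LinearMap.lsmul PadicEisenstein T λ')

/-- Membership in `λT`. [folklore] -/
theorem mem_lamSubmodule_iff {t : T} : t ∈ lamSubmodule T ↔ ∃ s : T, λ' • s = t := by
  simp [lamSubmodule]

/-- `λ • t ∈ λT`. [folklore] -/
theorem lam_smul_mem_lamSubmodule (t : T) : λ' • t ∈ lamSubmodule T :=
  mem_lamSubmodule_iff.2 ⟨t, rfl⟩

/-- `3T ⊆ λT` (`3 = -ω² λ²`). [folklore] -/
theorem three_smul_mem_lamSubmodule (t : T) : (3 : PadicEisenstein) • t ∈ lamSubmodule T := by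
  rw [three_eq, neg_smul, sq λ', ← mul_assoc, mul_smul]
  exact Submodule.neg_mem _ (Submodule.smul_mem _ _ (lam_smul_mem_lamSubmodule _))

variable [Module ℤ_[3] T] [IsScalarTower ℤ_[3] PadicEisenstein T]

/-- `3 • t = λ • λ • (-ω²) • t`. [folklore] -/
theorem three_smul_eq (t : T) : (3 : ℤ_[3]) • t = λ' • (λ' • (-(ω ^ 2) • t)) := by
  rw [← mul_smul, ← mul_smul, ← sq, show λ' ^ 2 * -(ω ^ 2) = (3 : PadicEisenstein) by rw [three_eq]; ring,
    show (3 : PadicEisenstein) = algebraMap ℤ_[3] PadicEisenstein 3 by rw [map_ofNat], algebraMap_smul]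

/-- `λ³ • t = 3 • (-(ωλ)) • t`. [folklore] -/
theorem lam_pow_three_smul (t : T) : λ' • (λ' • (λ' • t)) = (3 : ℤ_[3]) • (-(ω * λ') • t) := by
  rw [three_smul_eq, ← mul_smul, ← mul_smul, ← mul_smul, ← mul_smul, ← mul_smul]
  congr 1
  linear_combination (-(λ' ^ 3)) * omega_pow_three

variable [Module.Free ℤ_[3] T] [Module.Finite ℤ_[3] T]

/-- **Freeness over `ℤ₃[ω]`.**  Let `T` be a `ℤ₃[ω]`-module which is free of rank `2r` over `ℤ₃` and
with `#(T/λT) = 3^r`.  Then `T` is free of rank `r` over `ℤ₃[ω]`: lifts `t₁, …, t_r` of an `𝔽₃`-basis of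
`T/λT` generate `T` (`T = ∑ ℤ₃[ω] tᵢ + λT` gives `T = ∑ ℤ₃[ω] tᵢ + 3T` as `λ³ ∈ 3ℤ₃[ω]`, and Nakayama
over the local ring `ℤ₃` applies), and `ℤ₃[ω]^r → T` is then a surjection between free `ℤ₃`-modules of
the same rank `2r`, hence injective (Orzech / Vasconcelos).  (`ℤ₃[ω]` is a discrete valuation ring and
every finitely generated torsion-free module over it is free; this argument avoids that theory.)
[cite: SerreAbelianLadic1968, Ch. I §1.1] -/
theorem nonempty_basis_of_card_quotient {r : ℕ} (hrank : Module.finrank ℤ_[3] T = 2 * r)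
    (hcard : Nat.card (T ⧸ lamSubmodule T) = 3 ^ r) :
    Nonempty (Module.Basis (Fin r) PadicEisenstein T) := by
  classical
  -- `Q = T/λT` is an `𝔽₃`-vector space of dimension `r`
  have h3Q : ∀ q : T ⧸ lamSubmodule T, 3 • q = 0 := by
    intro q
    obtain ⟨t, rfl⟩ := Submodule.mkQ_surjective (lamSubmodule T) q
    rw [← map_nsmul, Submodule.mkQ_apply, Submodule.Quotient.mk_eq_zero,
      ← Nat.cast_smul_eq_nsmul PadicEisenstein, Nat.cast_ofNat]
    exact three_smul_mem_lamSubmodule t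
  letI : Module (ZMod 3) (T ⧸ lamSubmodule T) := AddCommGroup.zmodModule h3Q
  haveI : Finite (T ⧸ lamSubmodule T) := Nat.finite_of_card_ne_zero (by rw [hcard]; positivity)
  haveI : Module.Finite (ZMod 3) (T ⧸ lamSubmodule T) := Module.Finite.of_finite
  have hfin : Module.finrank (ZMod 3) (T ⧸ lamSubmodule T) = r := by
    have h := Module.natCard_eq_pow_finrank (K := ZMod 3) (V := T ⧸ lamSubmodule T)
    rw [hcard, Nat.card_zmod] at h
    exact (Nat.pow_right_injective (by norm_num) h).symm
  set b := Module.finBasisOfFinrankEq (ZMod 3) (T ⧸ lamSubmodule T) hfin with hb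
  -- lift the basis
  choose t ht using fun i => Submodule.Quotient.mk_surjective (lamSubmodule T) (b i)
  set φ : (Fin r → PadicEisenstein) →ₗ[PadicEisenstein] T := Fintype.linearCombination PadicEisenstein t
    with hφ
  set N : Submodule PadicEisenstein T := LinearMap.range φ with hN
  have htN : ∀ i, t i ∈ N := fun i => ⟨Pi.single i 1, by simp [hφ, Fintype.linearCombination_apply]⟩
  -- `N + λT = T`
  have hsup : ∀ x : T, ∃ n ∈ N, ∃ s : T, x = n + λ' • s := by
    intro x
    have hx : (lamSubmodule T).mkQ x ∈ Submodule.span (ZMod 3) (Set.range b) := by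
      rw [b.span_eq]; trivial
    -- a `ZMod 3`-combination of the `b i` is an `ℕ`-combination, hence the class of an element of `N`
    have hsub : ∀ q : T ⧸ lamSubmodule T, q ∈ Submodule.span (ZMod 3) (Set.range b) →
        ∃ n ∈ N, (lamSubmodule T).mkQ n = q := by
      intro q hq
      induction hq using Submodule.span_induction with
      | mem q hq =>
        obtain ⟨i, rfl⟩ := hq
        exact ⟨t i, htN i, ht i⟩
      | zero => exact ⟨0, N.zero_mem, map_zero _⟩
      | add q q' _ _ hq hq' =>
        obtain ⟨n, hn, rfl⟩ := hq
        obtain ⟨n', hn', rfl⟩ := hq'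
        exact ⟨n + n', N.add_mem hn hn', map_add _ _ _⟩
      | smul c q _ hq =>
        obtain ⟨n, hn, rfl⟩ := hq
        refine ⟨c.val • n, nsmul_mem hn _, ?_⟩
        rw [map_nsmul]
        conv_rhs => rw [← ZMod.natCast_zmod_val c, Nat.cast_smul_eq_nsmul]
    obtain ⟨n, hnN, hnx⟩ := hsub _ hx
    rw [Submodule.mkQ_apply, Submodule.mkQ_apply, Submodule.Quotient.eq] at hnx
    obtain ⟨s, hs⟩ := mem_lamSubmodule_iff.1 hnx
    exact ⟨n, hnN, -s, by rw [smul_neg, hs]; abel⟩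
  -- hence `N + 3T = T`
  have hsup3 : ∀ x : T, ∃ n ∈ N, ∃ s : T, x = n + (3 : ℤ_[3]) • s := by
    intro x
    obtain ⟨n₁, hn₁, s₁, rfl⟩ := hsup x
    obtain ⟨n₂, hn₂, s₂, hs₁⟩ := hsup s₁
    obtain ⟨n₃, hn₃, s₃, hs₂⟩ := hsup s₂
    refine ⟨n₁ + λ' • n₂ + λ' • (λ' • n₃), ?_, -(ω * λ') • s₃, ?_⟩
    · exact N.add_mem (N.add_mem hn₁ (N.smul_mem _ hn₂)) (N.smul_mem _ (N.smul_mem _ hn₃))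
    · rw [hs₁, hs₂, ← lam_pow_three_smul]
      simp only [smul_add]
      abel
  have hN3 : (⊤ : Submodule ℤ_[3] T) ≤
      N.restrictScalars ℤ_[3] ⊔ (IsLocalRing.maximalIdeal ℤ_[3]) • (⊤ : Submodule ℤ_[3] T) := by
    intro x _
    obtain ⟨n, hn, s, rfl⟩ := hsup3 x
    refine Submodule.add_mem_sup hn ?_
    rw [PadicInt.maximalIdeal_eq_span_p]
    exact Submodule.smul_mem_smul (Ideal.mem_span_singleton_self _) Submodule.mem_top
  -- Nakayama over `ℤ₃`
  have hNtop : (⊤ : Submodule ℤ_[3] T) ≤ N.restrictScalars ℤ_[3] :=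
    Submodule.le_of_le_smul_of_le_jacobson_bot Module.Finite.fg_top (IsLocalRing.maximalIdeal_le_jacobson _)
      hN3
  have hsurj : Function.Surjective φ := fun x =>
    LinearMap.mem_range.1 ((Submodule.restrictScalars_mem ℤ_[3] N x).1 (hNtop Submodule.mem_top))
  -- injectivity: a surjection between free `ℤ₃`-modules of the same finite rank
  have hrank' : Module.finrank ℤ_[3] (Fin r → PadicEisenstein) = Module.finrank ℤ_[3] T := by
    rw [Module.finrank_pi_fintype, finrank_eq_two, Finset.sum_const, Finset.card_univ, Fintype.card_fin,
      smul_eq_mul, hrank, mul_comm]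
  set e : T ≃ₗ[ℤ_[3]] (Fin r → PadicEisenstein) := LinearEquiv.ofFinrankEq _ _ hrank'.symm with he
  have hinj : Function.Injective φ := by
    have hg : Function.Surjective ((φ.restrictScalars ℤ_[3]).comp e.toLinearMap) := by
      simp only [LinearMap.coe_comp, LinearMap.coe_restrictScalars, LinearEquiv.coe_coe]
      exact hsurj.comp e.surjective
    have h := OrzechProperty.injective_of_surjective_endomorphism _ hg
    simp only [LinearMap.coe_comp, LinearMap.coe_restrictScalars, LinearEquiv.coe_coe] at h
    exact (Function.Injective.of_comp_iff' _ e.bijective).1 h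
  exact ⟨(Pi.basisFun PadicEisenstein (Fin r)).map (LinearEquiv.ofBijective φ ⟨hinj, hsurj⟩)⟩

end Free

/-! ### Traces: `ℤ₃`-trace versus `ℤ₃[ω]`-trace -/

section Trace

/-- The basis `{1, ω}` of `ℤ₃[ω]` over `ℤ₃`, indexed by `Fin 2`. [folklore] -/
def basisFinTwo : Module.Basis (Fin 2) ℤ_[3] PadicEisenstein :=
  powerBasis.basis.reindex (finCongr powerBasis_dim)

/-- `basisFinTwo i = ω ^ i`. [folklore] -/
theorem basisFinTwo_apply (i : Fin 2) : basisFinTwo i = ω ^ (i : ℕ) := by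
  rw [basisFinTwo, Module.Basis.reindex_apply, PowerBasis.coe_basis, powerBasis_gen]
  simp

/-- `basisFinTwo 0 = 1`. [folklore] -/
theorem basisFinTwo_zero : basisFinTwo 0 = 1 := by
  rw [basisFinTwo_apply]; simp

/-- `basisFinTwo 1 = ω`. [folklore] -/
theorem basisFinTwo_one : basisFinTwo 1 = ω := by
  rw [basisFinTwo_apply]; simp

/-- `Tr_{ℤ₃[ω]/ℤ₃}(ω) = -1`. [folklore] -/
theorem trace_omega : Algebra.trace ℤ_[3] PadicEisenstein ω = -1 := by
  classical
  rw [Algebra.trace_eq_matrix_trace basisFinTwo, Matrix.trace, Fin.sum_univ_two, Matrix.diag_apply,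
    Matrix.diag_apply, Algebra.leftMulMatrix_eq_repr_mul, Algebra.leftMulMatrix_eq_repr_mul,
    basisFinTwo_zero, mul_one, ← basisFinTwo_one, basisFinTwo.repr_self, Finsupp.single_eq_of_ne (by decide),
    basisFinTwo_one, show ω * ω = -basisFinTwo 0 - basisFinTwo 1 by
      rw [basisFinTwo_zero, basisFinTwo_one, ← sq]; linear_combination omega_sq_add_omega_add_one,
    map_sub, map_neg, basisFinTwo.repr_self, basisFinTwo.repr_self]
  simp

/-- `Tr_{ℤ₃[ω]/ℤ₃}(a + bω) = 2a - b`. [folklore] -/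
theorem trace_add_mul_omega (a b : ℤ_[3]) :
    Algebra.trace ℤ_[3] PadicEisenstein (algebraMap ℤ_[3] _ a + algebraMap ℤ_[3] _ b * ω) = 2 * a - b := by
  rw [map_add, Algebra.trace_algebraMap, finrank_eq_two, show algebraMap ℤ_[3] PadicEisenstein b * ω = b • ω by
    rw [Algebra.smul_def], map_smul, trace_omega, smul_eq_mul, nsmul_eq_mul, mul_neg_one, Nat.cast_ofNat]
  ring

end Trace

end PadicEisenstein

/-! ### Two generic trace lemmas

Used with `S = ℤ₃[ω]`: the `ℤ₃`-trace of an `ℤ₃[ω]`-linear endomorphism is the `ℤ₃[ω]/ℤ₃`-trace of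
its `ℤ₃[ω]`-trace, and an injective intertwiner between free modules of the same finite rank over a
domain preserves traces (reduction map on Tate modules). -/

section GenericTrace

/-- **`Tr_R(A) = Tr_{S/R}(Tr_S(A))`** for an `S`-linear endomorphism `A` of an `S`-module `M` that is
free of finite rank over `S`, `S` free of finite rank over `R` (computed in the basis `b i • c j`).
[folklore] -/
theorem trace_restrictScalars_eq_trace_trace {R S M : Type*} [CommRing R] [CommRing S]
    [Algebra R S] [AddCommGroup M] [Module R M] [Module S M] [IsScalarTower R S M] {ι κ : Type*}
    [Fintype ι] [Fintype κ] (b : Module.Basis ι R S) (c : Module.Basis κ S M) (A : M →ₗ[S] M) :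
    LinearMap.trace R M (A.restrictScalars R) = Algebra.trace R S (LinearMap.trace S M A) := by
  classical
  rw [LinearMap.trace_eq_matrix_trace R (b.smulTower c), LinearMap.trace_eq_matrix_trace S c,
    Matrix.trace, Matrix.trace, map_sum, Fintype.sum_prod_type, Finset.sum_comm]
  refine Finset.sum_congr rfl fun j _ => ?_
  rw [Matrix.diag_apply, LinearMap.toMatrix_apply, Algebra.trace_eq_matrix_trace b, Matrix.trace]
  refine Finset.sum_congr rfl fun i _ => ?_
  rw [Matrix.diag_apply, Matrix.diag_apply, LinearMap.toMatrix_apply, Algebra.leftMulMatrix_eq_repr_mul,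
    LinearMap.restrictScalars_apply, Module.Basis.smulTower_apply, map_smul, Module.Basis.smulTower_repr,
    map_smul, Finsupp.smul_apply, smul_eq_mul, mul_comm]

/-- **An injective intertwiner between free modules of the same finite rank over a domain preserves
traces**: if `f : M → M'` is injective `O`-linear, `rank M = rank M'`, and `f ∘ A = A' ∘ f`, then
`Tr A = Tr A'` (base change to the fraction field, over which `f` becomes an isomorphism).
[folklore] -/
theorem trace_eq_of_injective_of_comp_eq {O : Type*} [CommRing O] [IsDomain O] {M M' : Type*}
    [AddCommGroup M] [Module O M] [AddCommGroup M'] [Module O M'] [Module.Free O M] [Module.Finite O M]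
    [Module.Free O M'] [Module.Finite O M'] (hr : Module.finrank O M = Module.finrank O M')
    (f : M →ₗ[O] M') (hf : Function.Injective f) (A : M →ₗ[O] M) (A' : M' →ₗ[O] M')
    (h : f ∘ₗ A = A' ∘ₗ f) : LinearMap.trace O M A = LinearMap.trace O M' A' := by
  let K := FractionRing O
  apply IsFractionRing.injective O K
  rw [← LinearMap.trace_baseChange A K, ← LinearMap.trace_baseChange A' K]
  have hinj : Function.Injective (f.baseChange K) := by
    rw [LinearMap.baseChange_eq_ltensor]
    exact Module.Flat.lTensor_preserves_injective_linearMap _ hf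
  have hdim : Module.finrank K (TensorProduct O K M) = Module.finrank K (TensorProduct O K M') := by
    rw [Module.finrank_baseChange, Module.finrank_baseChange, hr]
  have hsurj := (LinearMap.injective_iff_surjective_of_finrank_eq_finrank hdim).1 hinj
  set e := LinearEquiv.ofBijective (f.baseChange K) ⟨hinj, hsurj⟩ with he
  have hc : f.baseChange K ∘ₗ A.baseChange K = A'.baseChange K ∘ₗ f.baseChange K := by
    rw [← LinearMap.baseChange_comp, ← LinearMap.baseChange_comp, h]
  have hconj : A'.baseChange K = e.conj (A.baseChange K) := by
    rw [LinearEquiv.conj_apply, LinearEquiv.eq_comp_toLinearMap_symm]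
    exact LinearMap.ext fun x => (LinearMap.congr_fun hc x).symm
  rw [hconj, LinearMap.trace_conj']

end GenericTrace

end Literature.NumberTheory.GaloisRepresentations
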